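import Literature.Analysis.FluidPDE.BKMClassVorticityTimeLipschitz
import Literature.Analysis.FluidPDE.NSVorticityBKMTools
import HarnessLib

/-!
# Time regularity of the vorticity in the BKM class, sup-norm form: `t ↦ ‖ω(t)‖_{L^∞}` is
# Lipschitz on closed slabs and continuous on half-open ones

Analysis/FluidPDE proof file (THEOREMS ONLY — no definition, no named fact), the `L^∞` sibling of
`BKMClassVorticityTimeLipschitz.lean` (`L²`-Lipschitz continuity, continuity of the `Lⁿ` norms,
`2 ≤ n < ∞`). For a classical Navier–Stokes solution `(u, p)` of the unforced system on a closed slab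
`[a, b] × ℝ³` (`a < b`) with all `L²` Sobolev norms of `u` bounded on `[a, b]`
(`HasBoundedSobolevNormsOn`, the Beale–Kato–Majda class of the tree; Majda–Bertozzi 2002, §3.2) it
proves:

* `IsClassicalNSSolutionOn.exists_norm_curl_timeDerivWithin_le` — **`sup_{[a,b] × ℝ³} |curl ∂ₜu| < ∞`**:
  the curl of the momentum equation `curl ∂ₜu = νΔω − (u·∇)ω + (ω·∇)u`
  (`IsClassicalNSSolutionOn.curl_timeDerivWithin_eq`, the pressure gradient being curl free) is bounded
  pointwise by `3|ν|κ‖D³u‖ + κ(sup|u|)‖D²u‖ + 4‖Du‖²`, `κ = ‖curlCLM‖`, and every derivative tensor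
  is bounded on the slab in the class (`exists_forall_norm_iteratedFDeriv_le_bkmClass`, Sobolev
  imbedding `W^{2,2}(ℝ³) ⊂ C_B`);
* `IsClassicalNSSolutionOn.exists_norm_curl_sub_curl_le` — **pointwise time-Lipschitz vorticity**
  `|ω(t,x) − ω(s,x)| ≤ Λ|t − s|` on `[a,b]`, uniformly in `x` (`∂ₜω = curl ∂ₜu` along time lines,
  `IsSmoothSpaceTimeOn.hasDerivWithinAt_curl_slice`, and the mean value inequality
  `Convex.norm_image_sub_le_of_norm_hasDerivWithin_le`);
* `IsClassicalNSSolutionOn.exists_abs_toReal_iSup_curl_sub_le` — **`t ↦ ‖ω(t)‖_∞` is Lipschitz on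
  `[a, b]`** (`‖ω(t)‖_∞ = (⨆ₓ ‖curl u(t,x)‖ₑ).toReal`, finite in the class);
* `IsClassicalNSSolutionOn.continuousOn_toReal_iSup_enorm_curl` (closed slab) and
  `IsClassicalNSSolutionOn.continuousOn_toReal_iSup_enorm_curl_Ico` — **continuity of `‖ω(t)‖_∞` on a
  half-open slab `[0, T)`** for a classical solution on `[0,T) × ℝ³` in the class on every closed sub-slab
  (the maximal-solution setting of `NSVorticityBKMMaximal`).

This is the `L^∞` part of «`v ∈ C([0,T); V^m) ∩ C¹([0,T); V^{m−2})`» (Majda–Bertozzi 2002, Thm. 3.5) read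
through the Sobolev imbedding; claim skeletons of the cell `ns-claims` (D-0090) that differentiate or compare
`W(t) = ‖ω(t)‖_∞` (e.g. `Literature.Claims.NS.Piromthan2025.Step_Wcont`, C164) consume the last theorem.
`-- TODO(general form): forced system (needs sup|curl f| on the slab); `Lⁿ`, `n < 2`.`

WHAT THIS IS NOT: not a claim about NS regularity or blow-up; not a claim about any author beyond the
typed locator.

## Mathlib / tree search

`lean search 'continuousOn_toReal_eLpNorm_curl|hasDerivWithinAt_curl_slice|exists_forall_norm_iteratedFDeriv_le_bkmClass|toReal_iSup_enorm'`:
the `Lⁿ` (`n ≥ 2`) continuity and the time-line derivative are in `BKMClassVorticityTimeLipschitz`; the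
derivative-tensor sup bounds in `NSVorticityBKMTools`; real-supremum helpers `norm_le_toReal_iSup_enorm` /
`toReal_iSup_enorm_le` exist in `ParticleTrajectoryFlowEstimates` (heavy import closure — three-line private
copies below); no sup-norm time continuity of the vorticity anywhere (`lean search 'ContinuousOn \(W |vortSup'`).
Mathlib: `Convex.norm_image_sub_le_of_norm_hasDerivWithin_le`, `LipschitzOnWith.of_dist_le_mul`,
`LipschitzOnWith.continuousOn`, `inter_mem_nhdsWithin`, `closure_Ioo`, `interior_Icc`.

## References

* A. J. Majda, A. L. Bertozzi, *Vorticity and Incompressible Flow*, CUP 2002 (held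
  `book:majda2002-vorticity-incompressible-flow`), §3.2.2 Thm. 3.5 (continuity in the high norm, PDF p. 92;
  proof PDF p. 98). [`MajdaBertozziCUP2002`]
* T. Tao, *Localisation and compactness properties of the Navier–Stokes global regularity problem*
  (2011), §10 (10.18) (the pointwise vorticity equation). [`Tao2011`]
* R. A. Adams, *Sobolev Spaces* (1975), Thm. 5.4 Part I Case C. [`Adams1975`]
* J. T. Beale, T. Kato, A. Majda, Comm. Math. Phys. 94 (1984) 61–66 (the class). [`BealeKatoMajda1984`]
-/

noncomputable section

open MeasureTheory Set Function Filter Topology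
open scoped ENNReal NNReal ContDiff

namespace Literature.Analysis.FluidPDE

/-! ## Real-supremum helpers (private copies of `ParticleTrajectoryFlowEstimates` lemmas) -/

section Sup

variable {ι : Type*} {F : Type*} [NormedAddCommGroup F] {f : ι → F} {B : ℝ}

/-- `⨆ ‖f‖ₑ ≤ ofReal B` from a pointwise bound. [folklore] -/
private theorem iSup_enorm_le_ofReal_supLip (hB : ∀ x, ‖f x‖ ≤ B) : (⨆ x, ‖f x‖ₑ) ≤ ENNReal.ofReal B :=
  iSup_le fun x => by rw [← ofReal_norm]; exact ENNReal.ofReal_le_ofReal (hB x)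

/-- `‖f x‖ ≤ (⨆ ‖f‖ₑ).toReal` for bounded `f`. [folklore] -/
private theorem norm_le_toReal_iSup_enorm_supLip (hB : ∀ x, ‖f x‖ ≤ B) (x : ι) :
    ‖f x‖ ≤ (⨆ x, ‖f x‖ₑ).toReal := by
  have htop : (⨆ x, ‖f x‖ₑ) ≠ ⊤ :=
    ne_top_of_le_ne_top ENNReal.ofReal_ne_top (iSup_enorm_le_ofReal_supLip hB)
  rw [← ENNReal.ofReal_le_iff_le_toReal htop, ofReal_norm]
  exact le_iSup (fun x => ‖f x‖ₑ) x

/-- `(⨆ ‖f‖ₑ).toReal ≤ B` from a pointwise bound, nonempty index. [folklore] -/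
private theorem toReal_iSup_enorm_le_supLip [Nonempty ι] (hB : ∀ x, ‖f x‖ ≤ B) :
    (⨆ x, ‖f x‖ₑ).toReal ≤ B := by
  have hB0 : 0 ≤ B := (norm_nonneg _).trans (hB (Classical.arbitrary ι))
  exact (ENNReal.toReal_mono ENNReal.ofReal_ne_top (iSup_enorm_le_ofReal_supLip hB)).trans
    (le_of_eq (ENNReal.toReal_ofReal hB0))

end Sup

/-! ## `sup |curl ∂ₜu| < ∞` on a closed slab in the class -/

/-- **Uniform bound of `curl ∂ₜu` on `[a, b] × ℝ³` in the BKM class.** The curl of the momentum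
equation, `curl ∂ₜu = νΔω − (u·∇)ω + (ω·∇)u` (`curl_timeDerivWithin_eq`; `ω = curl u`, the pressure
gradient is curl free), is bounded pointwise by `3|ν|κ‖D³u‖ + κ‖u‖‖D²u‖ + 4‖Du‖²` (`κ = ‖curlCLM‖`), and
in the class `‖Dᵐu‖ ≤ Bₘ` on the slab for every `m` (`exists_forall_norm_iteratedFDeriv_le_bkmClass`).
The `L^∞` form of «`∂ₜv ∈ L^∞([0,T]; V^{m−2})`». [cite: MajdaBertozziCUP2002, §3.2.2 Thm. 3.5 (PDF p. 92)]
[cite: Tao2011, §10 (10.18)] -/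
theorem IsClassicalNSSolutionOn.exists_norm_curl_timeDerivWithin_le {ν a b : ℝ}
    {u : ℝ → EuclideanSpace ℝ (Fin 3) → EuclideanSpace ℝ (Fin 3)}
    {p : ℝ → EuclideanSpace ℝ (Fin 3) → ℝ} (hS : IsClassicalNSSolutionOn (Icc a b) ν 0 u p)
    (hB : HasBoundedSobolevNormsOn (Icc a b) u) (hab : a < b) :
    ∃ Λ : ℝ, 0 ≤ Λ ∧ ∀ τ ∈ Icc a b, ∀ x, ‖curl (FluidPDE.timeDerivWithin (Icc a b) u τ) x‖ ≤ Λ := by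
  have hU : UniqueDiffOn ℝ (Icc a b) := uniqueDiffOn_Icc hab
  have hsm : ∀ s ∈ Icc a b, ContDiff ℝ ∞ (u s) := fun s hs => hS.contDiff_velocity hs
  obtain ⟨B₀, hB₀0, hB₀⟩ := exists_forall_norm_iteratedFDeriv_le_bkmClass hsm hB 0
  obtain ⟨B₁, hB₁0, hB₁⟩ := exists_forall_norm_iteratedFDeriv_le_bkmClass hsm hB 1
  obtain ⟨B₂, hB₂0, hB₂⟩ := exists_forall_norm_iteratedFDeriv_le_bkmClass hsm hB 2
  obtain ⟨B₃, hB₃0, hB₃⟩ := exists_forall_norm_iteratedFDeriv_le_bkmClass hsm hB 3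
  set κ : ℝ := ‖curlCLM‖ with hκ
  have hκ0 : 0 ≤ κ := norm_nonneg curlCLM
  refine ⟨|ν| * (3 * (κ * B₃)) + κ * B₂ * B₀ + B₁ * (4 * B₁), by positivity, fun τ hτ x => ?_⟩
  have hu : ContDiff ℝ ∞ (u τ) := hsm τ hτ
  have hu2 : ContDiff ℝ 2 (u τ) := hu.of_le (by norm_cast)
  have hu3 : ContDiff ℝ 3 (u τ) := hu.of_le (by norm_cast)
  have hcu2 : ContDiff ℝ 2 (curl (u τ)) := contDiff_curl (n := 2) (hu.of_le (by norm_cast))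
  have hux : ‖u τ x‖ ≤ B₀ := by
    have h := hB₀ τ hτ x
    rwa [norm_iteratedFDeriv_zero] at h
  have hDux : ‖fderiv ℝ (u τ) x‖ ≤ B₁ := by
    have h := hB₁ τ hτ x
    rwa [← norm_iteratedFDeriv_fderiv, norm_iteratedFDeriv_zero] at h
  rw [hS.curl_timeDerivWithin_eq hU hτ x]
  have e0 : curl ((0 : ℝ → EuclideanSpace ℝ (Fin 3) → EuclideanSpace ℝ (Fin 3)) τ) x = 0 :=
    curl_zero x
  have t1 : ‖ν • (Laplacian.laplacian (curl (u τ))) x‖ ≤ |ν| * (3 * (κ * B₃)) := by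
    rw [norm_smul, Real.norm_eq_abs]
    calc |ν| * ‖(Laplacian.laplacian (curl (u τ))) x‖
        ≤ |ν| * (3 * ‖iteratedFDeriv ℝ 2 (curl (u τ)) x‖) :=
          mul_le_mul_of_nonneg_left (norm_laplacian_le_three_mul_norm_iteratedFDeriv_two hcu2 x)
            (abs_nonneg ν)
      _ ≤ |ν| * (3 * (κ * ‖iteratedFDeriv ℝ 3 (u τ) x‖)) := by
          gcongr; exact norm_iteratedFDeriv_two_curl_le hu3 x
      _ ≤ |ν| * (3 * (κ * B₃)) := by gcongr; exact hB₃ τ hτ x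
  have t2 : ‖convect (u τ) (curl (u τ)) x‖ ≤ κ * B₂ * B₀ := by
    rw [convect_apply]
    calc ‖fderiv ℝ (curl (u τ)) x (u τ x)‖ ≤ ‖fderiv ℝ (curl (u τ)) x‖ * ‖u τ x‖ :=
          ContinuousLinearMap.le_opNorm _ _
      _ ≤ (κ * ‖iteratedFDeriv ℝ 2 (u τ) x‖) * B₀ :=
          mul_le_mul (norm_fderiv_curl_le hu2 x) hux (norm_nonneg _) (by positivity)
      _ ≤ (κ * B₂) * B₀ := by gcongr; exact hB₂ τ hτ x
  have t3 : ‖convect (curl (u τ)) (u τ) x‖ ≤ B₁ * (4 * B₁) := by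
    rw [convect_apply]
    calc ‖fderiv ℝ (u τ) x (curl (u τ) x)‖ ≤ ‖fderiv ℝ (u τ) x‖ * ‖curl (u τ) x‖ :=
          ContinuousLinearMap.le_opNorm _ _
      _ ≤ ‖fderiv ℝ (u τ) x‖ * (4 * ‖fderiv ℝ (u τ) x‖) :=
          mul_le_mul_of_nonneg_left (norm_curl_le_four_mul _ _) (norm_nonneg _)
      _ ≤ B₁ * (4 * B₁) := by gcongr
  rw [e0, add_zero]
  calc ‖ν • (Laplacian.laplacian (curl (u τ))) x - convect (u τ) (curl (u τ)) x +
          convect (curl (u τ)) (u τ) x‖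
      ≤ ‖ν • (Laplacian.laplacian (curl (u τ))) x‖ + ‖convect (u τ) (curl (u τ)) x‖ +
          ‖convect (curl (u τ)) (u τ) x‖ :=
        (norm_add_le _ _).trans (add_le_add (norm_sub_le _ _) le_rfl)
    _ ≤ _ := add_le_add (add_le_add t1 t2) t3

/-! ## Pointwise time-Lipschitz vorticity and the Lipschitz sup norm -/

/-- **`|ω(t,x) − ω(s,x)| ≤ Λ|t − s|` on `[a, b]`, uniformly in `x`, in the BKM class**: along each time
line `∂ₜω = curl ∂ₜu` (`IsSmoothSpaceTimeOn.hasDerivWithinAt_curl_slice`), bounded by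
`exists_norm_curl_timeDerivWithin_le`; mean value inequality on the convex set `[a, b]`.
[cite: MajdaBertozziCUP2002, §3.2.2 Thm. 3.5 (PDF p. 92)] -/
theorem IsClassicalNSSolutionOn.exists_norm_curl_sub_curl_le {ν a b : ℝ}
    {u : ℝ → EuclideanSpace ℝ (Fin 3) → EuclideanSpace ℝ (Fin 3)}
    {p : ℝ → EuclideanSpace ℝ (Fin 3) → ℝ} (hS : IsClassicalNSSolutionOn (Icc a b) ν 0 u p)
    (hB : HasBoundedSobolevNormsOn (Icc a b) u) (hab : a < b) :
    ∃ Λ : ℝ, 0 ≤ Λ ∧ ∀ s ∈ Icc a b, ∀ t ∈ Icc a b, ∀ x,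
      ‖curl (u t) x - curl (u s) x‖ ≤ Λ * |t - s| := by
  obtain ⟨Λ, hΛ0, hΛ⟩ := hS.exists_norm_curl_timeDerivWithin_le hB hab
  have hU : UniqueDiffOn ℝ (Icc a b) := uniqueDiffOn_Icc hab
  have hcl : Icc a b ⊆ closure (interior (Icc a b)) := by
    rw [interior_Icc, closure_Ioo hab.ne]
  refine ⟨Λ, hΛ0, fun s hs t ht x => ?_⟩
  have hder : ∀ τ ∈ Icc a b, HasDerivWithinAt (fun σ => curl (u σ) x)
      (curl (FluidPDE.timeDerivWithin (Icc a b) u τ) x) (Icc a b) τ := fun τ hτ =>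
    hS.smooth_velocity.hasDerivWithinAt_curl_slice hU hcl hτ x
  have h := (convex_Icc a b).norm_image_sub_le_of_norm_hasDerivWithin_le hder
    (fun τ hτ => hΛ τ hτ x) hs ht
  rwa [Real.norm_eq_abs] at h

/-- **`t ↦ ‖ω(t)‖_∞` is Lipschitz on `[a, b]` in the BKM class** (`‖ω(t)‖_∞ = (⨆ₓ ‖curl u(t,x)‖ₑ).toReal`,
finite on the slab by `exists_enorm_curl_le_of_hasBoundedSobolevNormsOn`): from the pointwise Lipschitz
bound, `‖ω(t)‖_∞ ≤ ‖ω(s)‖_∞ + Λ|t − s|` and symmetrically. [cite: MajdaBertozziCUP2002, §3.2.2 Thm. 3.5 (PDF p. 92)] -/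
theorem IsClassicalNSSolutionOn.exists_abs_toReal_iSup_curl_sub_le {ν a b : ℝ}
    {u : ℝ → EuclideanSpace ℝ (Fin 3) → EuclideanSpace ℝ (Fin 3)}
    {p : ℝ → EuclideanSpace ℝ (Fin 3) → ℝ} (hS : IsClassicalNSSolutionOn (Icc a b) ν 0 u p)
    (hB : HasBoundedSobolevNormsOn (Icc a b) u) (hab : a < b) :
    ∃ Λ : ℝ, 0 ≤ Λ ∧ ∀ s ∈ Icc a b, ∀ t ∈ Icc a b,
      |(⨆ x, ‖curl (u t) x‖ₑ).toReal - (⨆ x, ‖curl (u s) x‖ₑ).toReal| ≤ Λ * |t - s| := by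
  obtain ⟨Λ, hΛ0, hΛ⟩ := hS.exists_norm_curl_sub_curl_le hB hab
  have hsm : ∀ s ∈ Icc a b, ContDiff ℝ ∞ (u s) := fun s hs => hS.contDiff_velocity hs
  obtain ⟨R, hRtop, hR⟩ := exists_enorm_curl_le_of_hasBoundedSobolevNormsOn hsm hB
  -- real pointwise bound of the vorticity on the slab
  have hRr : ∀ τ ∈ Icc a b, ∀ x, ‖curl (u τ) x‖ ≤ R.toReal := fun τ hτ x =>
    (ENNReal.ofReal_le_iff_le_toReal hRtop.ne).1 (by rw [ofReal_norm]; exact hR τ hτ x)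
  -- one-sided estimate, both orders
  have key : ∀ s ∈ Icc a b, ∀ t ∈ Icc a b,
      (⨆ x, ‖curl (u t) x‖ₑ).toReal ≤ (⨆ x, ‖curl (u s) x‖ₑ).toReal + Λ * |t - s| := by
    intro s hs t ht
    refine toReal_iSup_enorm_le_supLip fun x => ?_
    have hsub := norm_sub_norm_le (curl (u t) x) (curl (u s) x)
    have hx := norm_le_toReal_iSup_enorm_supLip (hRr s hs) x
    have hL := hΛ s hs t ht x
    linarith
  refine ⟨Λ, hΛ0, fun s hs t ht => abs_sub_le_iff.2 ⟨?_, ?_⟩⟩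
  · linarith [key s hs t ht]
  · have h := key t ht s hs
    rw [abs_sub_comm] at h
    linarith

/-- **Continuity of `t ↦ ‖ω(t)‖_∞` on a closed slab `[a, b]` in the BKM class** (Lipschitz ⇒ continuous).
[cite: MajdaBertozziCUP2002, §3.2.2 Thm. 3.5 (PDF p. 92)] -/
theorem IsClassicalNSSolutionOn.continuousOn_toReal_iSup_enorm_curl {ν a b : ℝ}
    {u : ℝ → EuclideanSpace ℝ (Fin 3) → EuclideanSpace ℝ (Fin 3)}
    {p : ℝ → EuclideanSpace ℝ (Fin 3) → ℝ} (hS : IsClassicalNSSolutionOn (Icc a b) ν 0 u p)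
    (hB : HasBoundedSobolevNormsOn (Icc a b) u) (hab : a < b) :
    ContinuousOn (fun t => (⨆ x, ‖curl (u t) x‖ₑ).toReal) (Icc a b) := by
  obtain ⟨Λ, hΛ0, hΛ⟩ := hS.exists_abs_toReal_iSup_curl_sub_le hB hab
  have hLip : LipschitzOnWith (Real.toNNReal Λ) (fun t => (⨆ x, ‖curl (u t) x‖ₑ).toReal) (Icc a b) := by
    refine LipschitzOnWith.of_dist_le_mul fun s hs t ht => ?_
    rw [Real.dist_eq, Real.dist_eq, Real.coe_toNNReal _ hΛ0]
    exact hΛ t ht s hs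
  exact hLip.continuousOn

/-- **Continuity of `t ↦ ‖ω(t)‖_∞` on a half-open slab `[0, T)`** for a classical solution of the unforced
system on `[0, T) × ℝ³` lying in the BKM class on every closed sub-slab `[0, T'']`, `T'' < T` (the
maximal-solution setting): at `t₀ < T` work on `[0, (t₀ + T)/2]`. [cite: MajdaBertozziCUP2002, §3.2.2 Thm. 3.5 (PDF p. 92)] -/
theorem IsClassicalNSSolutionOn.continuousOn_toReal_iSup_enorm_curl_Ico {ν T : ℝ}
    {u : ℝ → EuclideanSpace ℝ (Fin 3) → EuclideanSpace ℝ (Fin 3)}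
    {p : ℝ → EuclideanSpace ℝ (Fin 3) → ℝ} (hS : IsClassicalNSSolutionOn (Ico 0 T) ν 0 u p)
    (hB : ∀ T'' < T, HasBoundedSobolevNormsOn (Icc 0 T'') u) :
    ContinuousOn (fun t => (⨆ x, ‖curl (u t) x‖ₑ).toReal) (Ico 0 T) := by
  intro t₀ ht₀
  set T'' : ℝ := (t₀ + T) / 2 with hT''
  have h1 : t₀ < T'' := by rw [hT'']; linarith [ht₀.2]
  have h2 : T'' < T := by rw [hT'']; linarith [ht₀.2]
  have h0 : 0 < T'' := ht₀.1.trans_lt h1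
  have hSI : IsClassicalNSSolutionOn (Icc 0 T'') ν 0 u p :=
    hS.mono (Icc_subset_Ico_right h2) (uniqueDiffOn_Icc h0)
  have hc := (hSI.continuousOn_toReal_iSup_enorm_curl (hB T'' h2) h0) t₀ ⟨ht₀.1, h1.le⟩
  refine hc.mono_of_mem_nhdsWithin ?_
  refine Filter.mem_of_superset (inter_mem_nhdsWithin (Ico 0 T) (Iio_mem_nhds h1)) ?_
  rintro s ⟨hs, hs'⟩
  exact ⟨hs.1, le_of_lt hs'⟩

end Literature.Analysis.FluidPDE

end

-- WHAT THIS IS NOT: not a claim about NS regularity or blow-up; not a claim about any author beyond the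
-- typed locator.
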